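import Literature.NumberTheory.EllipticCurves.PAdicGrossZagier
import Literature.NumberTheory.EllipticCurves.PadicSigmaOddPrime
import HarnessLib

/-!
# Perrin-Riou's `p`-adic Gross–Zagier theorem in leading-term form over `ℚ`, at an ODD prime

Topic `NumberTheory/EllipticCurves` (trunk T-NT-EC); companion of `PAdicGrossZagier.lean`. ONE named
fact: the statement of `perrinRiou_rankOne_leadingTerms` (B. Perrin-Riou, Invent. Math. 89 (1987),
Thm. 1.3 with (1.1) and §1.4 Cor. 1.8, in the leading-term form of Stein–Wuthrich 2013 §9) with its
range of primes restored to the printed one — `p` ODD — so that it serves `p = 3`. HONEST FRAMING (BSD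
rank-≤1 residual cell `b2b-bsdres`, unit `b2b-bsdres-x1b`, prover B, gen 4 — independent patchwork, no
preprint input): the cell deletes the COMBINATION-SHAPED residual classes of the rank-`≤ 1` BSD formula
STRICTLY from published theorems and TYPES the remainder; this is not "finishing BSD". Consumer: the
rank-one `p`-adic engine at a reducible good ordinary prime (`Wuthrich2014/RankOneEngineOddPrimeProofs`),
for the rank-one census pairs of class X1 at `p = 3`.

## Why the tree's fact says `5 ≤ p`, and why `p ≠ 2` is faithful

`PAdicGrossZagier.lean`, docstring of `perrinRiou_rankOne_leadingTerms`: "`p ≥ 5` (source: `p` odd)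
because the tree's canonical height is set up for `p ≥ 5`"; module docstring: "Hypotheses are those of
PR87 §1.4 in tree terms, with `p ≥ 5` (PR: `p` odd) because the tree's sigma-function height is set up
for `p ≥ 5`". That vocabulary now exists at every odd good ordinary prime (`PadicSigmaOddPrime.lean`:
`existsUnique_isCanonical_of_odd`, from the single fact `mazur_tate_sigma_exists_odd`; Balakrishnan 2016
§2: the sigma formula is the cyclotomic `p`-adic height for "`p` an odd prime of good ordinary
reduction"). The source's standing hypothesis is `p` odd: Perrin-Riou, Bull. Soc. Math. France 115
(1987) (the companion announcement, held: `paper:doi-10-24033-bsmf-2085`, p. 5): "Soit `k` un corps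
quadratique imaginaire et `p` un nombre premier impair"; B. Howard, Compositio Math. 141 (2005) (held:
`paper:arxiv-1202.6349`, §1): "Fix forever a rational prime `p > 2` … Assume that `(p, DN) = 1` and that
`f` is ordinary at `p` … The case `s = 0` of the following theorem is due to Perrin-Riou [pr1]"
(Theorem 1, with `D` odd `≠ -3` and `ε(p) = 1`). So the transcription at the printed generality replaces
`5 ≤ p` by `p ≠ 2` and nothing else; the auxiliary Heegner field (`p` split, `D` odd, Heegner hypothesis,
`L(E^{(D)},1) ≠ 0`) stays inside the existential exactly as in the `p ≥ 5` fact (its docstring, audited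
when that fact landed for stmt-BirchSwinnertonDyer-16219).

## Sources (read for this file)

* B. Perrin-Riou, *Points de Heegner et dérivées de fonctions `L` `p`-adiques*, Invent. Math. 89 (1987)
  455–510, §1.4 Thm. 1.3, (1.1), Cor. 1.8 (statement as transcribed in the tree's `PAdicGrossZagier.lean`
  from the page images, pp. 459–463). (`PerrinRiou1987`) PRIMARY RE-READ 2026-08-19 (cell `b2b-bsdres`,
  literature seat gen 7) on the open GDZ scan of Invent. Math. vol. 89
  (gdz.sub.uni-goettingen.de, PPN356556735_0089, LOG_0027; page images in
  run/shared/lean/b2b/bsd-rank1-residual/b2b-bsdres-lit/g7/pr87/): the range of `p` IN THE PRIMARY is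
  p. 455 (Introduction) "Choisissons maintenant un nombre premier `p` impair premier à `N`, se décomposant
  dans `k` et ordinaire pour `f`"; p. 456 §1.1 "(H.1) `p` ne divise pas `N`; (H.2) l'image de `a_p(f)`
  par `i_p` est une unité"; p. 461 §1.4 "Nous supposons que `p` ne divise pas `N`, que `f` est
  ordinaire en `i_p`, que tout diviseur premier de `Np` se décompose dans `k` et que `D` est impair"
  (Thm. 1.3); p. 463 "On suppose désormais uniquement que `E` a bonne réduction ordinaire en `p` et que
  `f ∣ W_N = f`", the field `k` with (i) every prime of `Np` split, (ii) `L(E^{(ε)}/ℚ, 1) ≠ 0` existing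
  "par un théorème de Waldspurger"; p. 464 Cor. 1.8 and `Ω_E⁺ = |∫_{E(ℝ)} ω|`. So "`p` odd, good
  ordinary" below is the primary's own range (the two secondary citations that follow corroborate it).
* B. Perrin-Riou, *Fonctions `L` `p`-adiques, théorie d'Iwasawa et points de Heegner*, Bull. Soc. Math.
  France 115 (1987) 399–456, p. 5 ("`p` un nombre premier impair"). (`PerrinRiou1987BSMF`)
* B. Howard, *The Iwasawa theoretic Gross–Zagier theorem*, Compositio Math. 141 (2005) 811–846, §1
  (quoted above). (`Howard2005`)
* W. Stein, C. Wuthrich, Math. Comp. 82 (2013), §9 (the leading-term form; quoted in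
  `PAdicGrossZagier.lean`). (`SteinWuthrich2013`)
* J. S. Balakrishnan, J. Number Theory 161 (2016), §2 (height normalisation at odd `p`). (`Balakrishnan2016`)

## What is here

* `perrinRiou_rankOne_leadingTerms_odd` (NAMED FACT, nothing asserted): byte-identical to
  `perrinRiou_rankOne_leadingTerms` except `5 ≤ p` ↦ `p ≠ 2`;
* proved: `perrinRiou_rankOne_leadingTerms.of_odd` (the tree's `p ≥ 5` fact is the special case);
  `perrinRiou_rankOne_leadingTerms_odd.exists_canonical` (non-vacuity of the `∀ D, D.IsCanonical → …`
  binder at odd `p`, via `existsUnique_isCanonical_of_odd`).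

## Design notes

* A NEW def rather than an edit (append-only Literature; many consumers of the old fact). Residual trust
  added: the instances `p = 3` of Perrin-Riou's theorem.
* Not here: `p = 2`; the supersingular case (Kobayashi 2013); Disegni's generalisations.
-/

noncomputable section

open scoped MatrixGroups ModularForm
open CongruenceSubgroup NumberField Literature.NumberTheory.EllipticCurves.ModularForms

namespace Literature.NumberTheory.EllipticCurves

/-! ### The named fact -/

/-- **Perrin-Riou's `p`-adic Gross–Zagier theorem in its leading-term form over `ℚ` (analytic rank
one), at an odd prime.** (B. Perrin-Riou, Invent. Math. 89 (1987), Thm. 1.3 with the factorisation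
(1.1) and §1.4 Cor. 1.8, for `p` ODD (Introduction; companion Bull. SMF 115 (1987) p. 5: "`p` un nombre
premier impair"; Howard, Compositio 141 (2005) §1: "Fix forever a rational prime `p > 2` … The case
`s = 0` of the following theorem is due to Perrin-Riou"); restated in the present normalisations by
Stein–Wuthrich 2013, §9. The tree's `perrinRiou_rankOne_leadingTerms` is the same statement narrowed to
`p ≥ 5` "because the tree's canonical height is set up for `p ≥ 5`" — vocabulary now available at odd
`p`, `PadicSigmaOddPrime.lean`.) Let `E/ℚ` be an elliptic curve with globally minimal model `W`, `p ≠ 2`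
a prime of good ORDINARY reduction with unit root `α = unitRoot W p`, `D` THE canonical cyclotomic
`p`-adic height datum on `E(ℚ)` (`D.IsCanonical`, sigma-function normalisation; Balakrishnan 2016 §2 at
odd `p`), and `f` the newform of `E`; suppose `ord_{s=1} L(E,s) = 1`. Then there are a point `P ∈ E(ℚ)`
of infinite order (in the source: the trace of a Heegner point over an imaginary quadratic `K` with the
Heegner hypothesis, `p` split in `K`, `D_K` odd, `L(E^{(D_K)},1) ≠ 0`) and a rational `c` (namely
`L'(E,1)/(Ω⁺_f·ĥ(P))`, rational by Gross–Zagier 1986) with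
`L'(E,1) = c · Ω⁺_f · ĥ(P)` and `[T¹]L_p(f,α,T) · log_p(γ) = c · (1 - α⁻¹)² · ⟨P,P⟩_D`
(tree normalisations exactly as in `perrinRiou_rankOne_leadingTerms`: `L_p(f,α,T) = padicLFunction f α`,
`γ = cyclotomicGenerator p = 1 + p`, `ĥ = canonicalHeight`, `⟨P,P⟩_D = D.pairing P P`, `log_p` the
Iwasawa logarithm). Only the existence of `(P, c)` is recorded — implied by, never stronger than, the
source. Named fact (D-0014): nothing is asserted; users take `(h : perrinRiou_rankOne_leadingTerms_odd)`.
[cite: PerrinRiou1987, Thm. 1.3, (1.1) and §1.4 Cor. 1.8]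
[cite: PerrinRiou1987, p. 455 ("un nombre premier p impair premier à N … ordinaire pour f"), p. 456 (H.1)–(H.2), p. 461 §1.4, p. 464 Cor. 1.8 — primary re-read 2026-08-19 on the GDZ scan]
[cite: PerrinRiou1987BSMF, p. 5 ("p un nombre premier impair")]
[cite: Howard2005, §1 (p > 2; "the case s = 0 … is due to Perrin-Riou")]
[cite: SteinWuthrich2013, §9] [cite: Balakrishnan2016, §2] -/
def perrinRiou_rankOne_leadingTerms_odd : Prop :=
  ∀ (W : WeierstrassCurve ℚ) [W.IsElliptic] [W.IsGloballyMinimal] (p : ℕ) [Fact p.Prime],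
    p ≠ 2 → IsOrdinaryAt W p → W.analyticRank = 1 →
    ∀ (D : WeierstrassCurve.PAdicHeightData W p), D.IsCanonical →
    ∀ ⦃N : ℕ⦄ [NeZero N] (f : CuspForm (Gamma0 N) 2), IsNewformOf W f →
    ∃ (P : W.toAffine.Point) (c : ℚ), ¬ IsOfFinAddOrder P ∧
      deriv W.entireLFunction 1 = (((c : ℝ) * plusPeriod f * P.canonicalHeight : ℝ) : ℂ) ∧
      PowerSeries.coeff 1 (padicLFunction f (unitRoot W p : ℚ_[p])) *
          padicLog p (cyclotomicGenerator p) =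
        (c : ℚ_[p]) * (1 - (unitRoot W p : ℚ_[p])⁻¹) ^ 2 * D.pairing P P

/-! ### The tree's `p ≥ 5` fact is a special case -/

/-- **`perrinRiou_rankOne_leadingTerms_odd` implies the tree's `perrinRiou_rankOne_leadingTerms`**
(`5 ≤ p ⇒ p ≠ 2`). [cite: PerrinRiou1987, §1.4 Cor. 1.8] -/
theorem perrinRiou_rankOne_leadingTerms.of_odd (h : perrinRiou_rankOne_leadingTerms_odd) :
    perrinRiou_rankOne_leadingTerms := by
  intro W _ _ p _ hp hord han D hD N _ f hf
  exact h W p (by omega) hord han D hD f hf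

/-- Non-vacuity of the height binder at an odd prime: under `mazur_tate_sigma_exists_odd` the clause
`∀ D, D.IsCanonical → …` of `perrinRiou_rankOne_leadingTerms_odd` is instantiated by THE canonical datum
(`existsUnique_isCanonical_of_odd`), giving Perrin-Riou's pair `(P, c)` for it.
[cite: PerrinRiou1987, §1.4 Cor. 1.8] [cite: Balakrishnan2016, §2 eq. (2.3)] -/
theorem perrinRiou_rankOne_leadingTerms_odd.exists_canonical (h : perrinRiou_rankOne_leadingTerms_odd)
    (hex : mazur_tate_sigma_exists_odd)
    (W : WeierstrassCurve ℚ) [W.IsElliptic] [W.IsGloballyMinimal] (p : ℕ) [Fact p.Prime]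
    (hp : p ≠ 2) (hord : IsOrdinaryAt W p) (han : W.analyticRank = 1)
    {N : ℕ} [NeZero N] (f : CuspForm (Gamma0 N) 2) (hf : IsNewformOf W f) :
    ∃ (D : WeierstrassCurve.PAdicHeightData W p) (P : W.toAffine.Point) (c : ℚ), D.IsCanonical ∧
      ¬ IsOfFinAddOrder P ∧
      deriv W.entireLFunction 1 = (((c : ℝ) * plusPeriod f * P.canonicalHeight : ℝ) : ℂ) ∧
      PowerSeries.coeff 1 (padicLFunction f (unitRoot W p : ℚ_[p])) *
          padicLog p (cyclotomicGenerator p) =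
        (c : ℚ_[p]) * (1 - (unitRoot W p : ℚ_[p])⁻¹) ^ 2 * D.pairing P P := by
  obtain ⟨D, hD, -⟩ := existsUnique_isCanonical_of_odd hex W p hp hord.1 hord.2
  obtain ⟨P, c, hP, h1, h2⟩ := h W p hp hord han D hD f hf
  exact ⟨D, P, c, hD, hP, h1, h2⟩

end Literature.NumberTheory.EllipticCurves

end
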